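import Mathlib
import Summits.PneNP.PneNP.Theorems.Nc03AvoidResidualCoreReductionSolveKit
import Summits.PneNP.PneNP.Theorems.Nc03AvoidResidualCoreReductionBfsB
import Literature.Computability.Complexity.CodeFPInvFolds
import Literature.Computability.Complexity.CodeFPStrings
import Literature.Computability.Complexity.CodeFPTableKit

/-!
# Route Nc03AvoidResidualCore, item `ResidualCoreReduction` — the solver, IX: BFS as a program, balls to depth

Helper file for `stmt-PneNP-20227` (cell pnp-ideate). The `MAJ₃`/`MUX` certificates are built from
BFS forests of bipartite multigraphs (`…ReductionBfs*`, on `Bip (Fin M) (Fin K)`); this file starts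
their LIST-LEVEL counterparts, to be run by the polynomial-time solver: graph data `GD = (K, edge
entries (j, eA j, eB j))`, edge and vertex sets as bit strings, and the programs `adjP`, `stepP`,
`ballP` (iterated BFS step), `reachP`, `rootP` (least reaching vertex), `depthP` (least radius) —
each proved EQUAL to the mathematical notion on genuine data (`adjP_iff`, `ballP_iff`, `rootP_eq`,
`depthP_eq`) and polynomial time in the `CodeFP` algebra (`codeFP_ballP`, `codeFP_rootP`,
`codeFP_depthP`; the BFS iteration has a fixed-length accumulator, `CodeFP.iterateInv`).
-/

set_option linter.dupNamespace false -- `Summit.PneNP.PneNP.…`: summit = sub-problem name (D-0017 single-conjunct layout)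

namespace Summit.PneNP.PneNP.Theorems.Nc03Reduction

open Literature.Computability.Complexity CodeFP

/-! ## Graph data and the programs -/

/-- Graph data: the number of vertices and the edge entries `(index, A-end, B-end)`. -/
abbrev GD := ℕ × List (ℕ × ℕ × ℕ)

/-- The code of graph data: vertex count in unary, entries in binary. -/
def gdE : GD → List Bool := pairE unE (rawE tripE)

/-- The graph data of a bipartite multigraph on `Fin M`, `Fin K`. -/
def gdOf {M K : ℕ} (G : Bip (Fin M) (Fin K)) : GD :=
  (K, List.ofFn fun j : Fin M => (j.val, (G.eA j).val, (G.eB j).val))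

/-- Adjacency along the edge set `E` (a bit string over edge indices). -/
def adjP (gd : GD) (E : List Bool) (u w : ℕ) : Bool :=
  !decide (u = w) && gd.2.any fun t => E.getD t.1 false &&
    ((decide (u = t.2.1) || decide (u = t.2.2)) && (decide (w = t.2.1) || decide (w = t.2.2)))

/-- One BFS step on a vertex bit string. -/
def stepP (gd : GD) (E : List Bool) (S : List Bool) : List Bool :=
  (List.range gd.1).map fun w => S.getD w false ||
    (List.range gd.1).any fun u => S.getD u false && adjP gd E u w

/-- The ball of radius `0`: the bit string of `{r}`. -/
def ball0P (gd : GD) (r : ℕ) : List Bool := (List.range gd.1).map fun w => decide (w = r)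

/-- The ball of radius `k` around `r`. -/
def ballP (gd : GD) (E : List Bool) (r k : ℕ) : List Bool := (stepP gd E)^[k] (ball0P gd r)

/-- Reachability: membership in the ball of radius `K`. -/
def reachP (gd : GD) (E : List Bool) (r w : ℕ) : Bool := (ballP gd E r gd.1).getD w false

/-- The root: the least vertex reaching `w`. -/
def rootP (gd : GD) (E : List Bool) (w : ℕ) : ℕ :=
  ((List.range gd.1).find? fun r => reachP gd E r w).getD 0

/-- The least radius (capped search) at which the ball around `r` contains `w`. -/
def depthAtP (gd : GD) (E : List Bool) (r w : ℕ) : ℕ :=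
  ((List.range (gd.1 + 1)).find? fun k => (ballP gd E r (min k (gd.1 + 1))).getD w false).getD 0

/-- The depth: the least radius at which the root's ball contains `w`. -/
def depthP (gd : GD) (E : List Bool) (w : ℕ) : ℕ := depthAtP gd E (rootP gd E w) w

/-! ## Agreement with `Bip` -/

/-- A least witness below `L` is what `find?` over `range L` returns. -/
theorem find?_range_eq_some {p : ℕ → Bool} {L m : ℕ} (hm : m < L) (hp : p m = true)
    (hmin : ∀ i < m, p i = false) : (List.range L).find? p = some m := by
  rw [List.find?_eq_some_iff_getElem]
  refine ⟨hp, m, by simpa using hm, by simp, fun j hj => ?_⟩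
  simp only [List.getElem_range]
  rw [hmin j hj]; rfl

section Bridge

variable {M K : ℕ} (G : Bip (Fin M) (Fin K)) (S : Finset (Fin M)) (E : List Bool)

/-- The bit string `E` represents the edge set `S`. -/
def RepE : Prop := ∀ j : Fin M, E.getD j.val false = decide (j ∈ S)

variable {G S E}

/-- Entries of the graph data are the genuine edges. -/
theorem mem_gdOf {t : ℕ × ℕ × ℕ} : t ∈ (gdOf G).2 ↔ ∃ j : Fin M, t = (j.val, (G.eA j).val, (G.eB j).val) := by
  unfold gdOf
  simp only [List.mem_ofFn]
  constructor
  · rintro ⟨j, rfl⟩; exact ⟨j, rfl⟩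
  · rintro ⟨j, rfl⟩; exact ⟨j, rfl⟩

/-- The vertex count of the graph data. -/
@[simp] theorem gdOf_fst : (gdOf G).1 = K := rfl

/-- **Adjacency**: the program agrees with `Bip.Adj`. -/
theorem adjP_iff (hE : RepE S E) (u w : Fin K) : adjP (gdOf G) E u.val w.val = true ↔ G.Adj S u w := by
  unfold adjP Bip.Adj
  rw [Bool.and_eq_true, Bool.not_eq_true', decide_eq_false_iff_not, List.any_eq_true]
  simp only [Bool.and_eq_true, Bool.or_eq_true, decide_eq_true_eq]
  constructor
  · rintro ⟨hne, t, ht, hE', hu, hw⟩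
    obtain ⟨j, rfl⟩ := mem_gdOf.1 ht
    simp only at hE' hu hw
    rw [hE j, decide_eq_true_eq] at hE'
    refine ⟨fun h => hne (congrArg Fin.val h), j, hE', ?_, ?_⟩
    · rw [G.mem_ends]
      rcases hu with h | h
      · exact Or.inl (Fin.ext h)
      · exact Or.inr (Fin.ext h)
    · rw [G.mem_ends]
      rcases hw with h | h
      · exact Or.inl (Fin.ext h)
      · exact Or.inr (Fin.ext h)
  · rintro ⟨hne, j, hj, hu, hw⟩
    refine ⟨fun h => hne (Fin.ext h), (j.val, (G.eA j).val, (G.eB j).val), mem_gdOf.2 ⟨j, rfl⟩, ?_, ?_, ?_⟩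
    · show E.getD j.val false = true
      rw [hE j]; exact decide_eq_true hj
    · rw [G.mem_ends] at hu
      rcases hu with h | h
      · exact Or.inl (congrArg Fin.val h)
      · exact Or.inr (congrArg Fin.val h)
    · rw [G.mem_ends] at hw
      rcases hw with h | h
      · exact Or.inl (congrArg Fin.val h)
      · exact Or.inr (congrArg Fin.val h)

/-- The BFS step preserves the length `K`. -/
@[simp] theorem length_stepP (gd : GD) (E S : List Bool) : (stepP gd E S).length = gd.1 := by simp [stepP]

/-- The initial ball has length `K`. -/
@[simp] theorem length_ball0P (gd : GD) (r : ℕ) : (ball0P gd r).length = gd.1 := by simp [ball0P]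

/-- Unfolding one BFS step. -/
theorem ballP_succ (gd : GD) (E : List Bool) (r k : ℕ) :
    ballP gd E r (k + 1) = stepP gd E (ballP gd E r k) := by
  unfold ballP; rw [Function.iterate_succ_apply']

/-- Balls have length `K`. -/
@[simp] theorem length_ballP (gd : GD) (E : List Bool) (r k : ℕ) : (ballP gd E r k).length = gd.1 := by
  induction k with
  | zero => simp [ballP]
  | succ k ih => rw [ballP_succ, length_stepP]

/-- **Balls**: the program agrees with `Bip.ball`. -/
theorem ballP_iff (hE : RepE S E) (r : Fin K) (k : ℕ) (w : Fin K) :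
    (ballP (gdOf G) E r.val k).getD w.val false = true ↔ w ∈ G.ball S r k := by
  induction k generalizing w with
  | zero =>
    unfold ballP ball0P
    simp only [Function.iterate_zero, id_eq, gdOf_fst]
    rw [List.getD_eq_getElem?_getD, List.getElem?_map, List.getElem?_range w.isLt, G.mem_ball_zero]
    simp [Fin.ext_iff]
  | succ k ih =>
    rw [ballP_succ, G.mem_ball_succ]
    unfold stepP
    rw [List.getD_eq_getElem?_getD, List.getElem?_map, List.getElem?_range (by simp [w.isLt])]
    simp only [Option.map_some, Option.getD_some, Bool.or_eq_true, List.any_eq_true, List.mem_range,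
      Bool.and_eq_true, gdOf_fst]
    rw [ih w]
    constructor
    · rintro (h | ⟨u, hu, hball, hadj⟩)
      · exact Or.inl h
      · exact Or.inr ⟨⟨u, hu⟩, (ih ⟨u, hu⟩).1 hball, (adjP_iff hE ⟨u, hu⟩ w).1 hadj⟩
    · rintro (h | ⟨u, hball, hadj⟩)
      · exact Or.inl h
      · exact Or.inr ⟨u.val, u.isLt, (ih u).2 hball, (adjP_iff hE u w).2 hadj⟩

/-- **Reachability**: the program agrees with `Bip.Reach`. -/
theorem reachP_iff (hE : RepE S E) (r w : Fin K) : reachP (gdOf G) E r.val w.val = true ↔ G.Reach S r w := by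
  unfold reachP Bip.Reach
  rw [gdOf_fst, ballP_iff hE, Fintype.card_fin]

/-- **Roots**: the program agrees with `Bip.root`. -/
theorem rootP_eq (hE : RepE S E) (w : Fin K) : rootP (gdOf G) E w.val = (G.root S w).val := by
  unfold rootP
  rw [gdOf_fst, find?_range_eq_some (p := fun r => reachP (gdOf G) E r w.val) (m := (G.root S w).val)
    (G.root S w).isLt ((reachP_iff hE _ _).2 (G.root_reach S w)) fun i hi => ?_]
  · rfl
  · cases h : reachP (gdOf G) E i w.val
    · rfl
    · exfalso
      have hr := (reachP_iff hE ⟨i, lt_trans hi (G.root S w).isLt⟩ w).1 h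
      have hle := G.root_le hr
      rw [Fin.le_def] at hle
      exact absurd hle (by simp only; omega)

/-- The depth is at most the number of vertices. -/
theorem depth_le_K (w : Fin K) : G.depth S w ≤ K := by
  have h := G.root_reach S w
  unfold Bip.Reach at h
  rw [Fintype.card_fin] at h
  exact G.depth_le h

/-- **Depth below a given root**: the capped least-radius search from the true root finds the depth. -/
theorem depthAtP_eq (hE : RepE S E) (w : Fin K) :
    depthAtP (gdOf G) E (G.root S w).val w.val = G.depth S w := by
  unfold depthAtP
  have hK := depth_le_K (G := G) (S := S) w
  rw [gdOf_fst, find?_range_eq_some (m := G.depth S w) (by omega) ?_ fun i hi => ?_]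
  · rfl
  · rw [min_eq_left (by omega)]
    exact (ballP_iff hE _ _ _).2 (G.depth_spec S w)
  · rw [min_eq_left (by omega)]
    cases h : (ballP (gdOf G) E (G.root S w).val i).getD w.val false
    · rfl
    · exfalso
      have := G.depth_le ((ballP_iff hE _ _ _).1 h)
      omega

/-- **Depth**: the program agrees with `Bip.depth`. -/
theorem depthP_eq (hE : RepE S E) (w : Fin K) : depthP (gdOf G) E w.val = G.depth S w := by
  unfold depthP
  rw [rootP_eq hE, depthAtP_eq hE]

end Bridge

/-! ## Polynomial time -/

/-- The code of a (graph data, edge bit string) context. -/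
abbrev ceE : GD × List Bool → List Bool := pairE gdE strE

/-- Adjacency is polynomial time. -/
theorem codeFP_adjP : CodeFP (pairE ceE (pairE natE natE)) bitE (fun q => adjP q.1.1 q.1.2 q.2.1 q.2.2) := by
  have hp : CodeFP (pairE (pairE ceE (pairE natE natE)) tripE) bitE
      (fun y => y.1.1.2.getD y.2.1 false &&
        ((decide (y.1.2.1 = y.2.2.1) || decide (y.1.2.1 = y.2.2.2)) &&
          (decide (y.1.2.2 = y.2.2.1) || decide (y.1.2.2 = y.2.2.2)))) :=
    ((strGetDNat.comp ((fst _ _).fst'.snd'.pair (snd _ _).fst')).and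
      (((codeFP_eqTest (fst _ _).snd'.fst' (snd _ _).snd'.fst').or
        (codeFP_eqTest (fst _ _).snd'.fst' (snd _ _).snd'.snd')).and
        ((codeFP_eqTest (fst _ _).snd'.snd' (snd _ _).snd'.fst').or
          (codeFP_eqTest (fst _ _).snd'.snd' (snd _ _).snd'.snd')))).congr fun _ => rfl
  exact ((codeFP_eqTest (snd _ _).fst' (snd _ _).snd').not.and
    ((any hp).comp ((CodeFP.id _).pair (fst _ _).fst'.snd'))).congr fun _ => rfl

/-- The BFS step is polynomial time. -/
theorem codeFP_stepP : CodeFP (pairE ceE strE) strE (fun q => stepP q.1.1 q.1.2 q.2) := by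
  -- inner test `u ↦ S[u] && adjP gd E u w` in context `((ce, S), w)`
  have hu : CodeFP (pairE (pairE (pairE ceE strE) natE) natE) bitE
      (fun y => y.1.1.2.getD y.2 false && adjP y.1.1.1.1 y.1.1.1.2 y.2 y.1.2) :=
    ((strGetDNat.comp ((fst _ _).fst'.snd'.pair (snd _ _))).and
      (codeFP_adjP.comp ((fst _ _).fst'.fst'.pair ((snd _ _).pair (fst _ _).snd')))).congr fun _ => rfl
  have hK : CodeFP (pairE ceE strE) unE (fun q => q.1.1.1) := (fst _ _).fst'.fst'
  -- outer item `w ↦ S[w] || any u`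
  have hw : CodeFP (pairE (pairE ceE strE) natE) bitE
      (fun y => y.1.2.getD y.2 false ||
        (List.range y.1.1.1.1).any fun u => y.1.2.getD u false && adjP y.1.1.1 y.1.1.2 u y.2) :=
    ((strGetDNat.comp ((fst _ _).snd'.pair (snd _ _))).or
      ((any hu).comp ((CodeFP.id _).pair (urange.comp (hK.comp (fst _ _)))))).congr fun _ => rfl
  exact (bitsToStr.comp ((map hw).comp ((CodeFP.id _).pair (urange.comp hK)))).congr fun _ => rfl

/-- The initial ball is polynomial time. -/
theorem codeFP_ball0P : CodeFP (pairE gdE natE) strE (fun q => ball0P q.1 q.2) := by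
  have hw : CodeFP (pairE (pairE gdE natE) natE) bitE (fun y => decide (y.2 = y.1.2)) :=
    codeFP_eqTest (snd _ _) (fst _ _).snd'
  exact (bitsToStr.comp ((map hw).comp ((CodeFP.id _).pair (urange.comp (fst _ _).fst')))).congr
    fun _ => rfl

/-- Graph data codes are at least as long as the vertex count. -/
theorem K_le_length_gdE (gd : GD) : gd.1 ≤ (gdE gd).length := by
  unfold gdE; rw [pairE_apply, length_boolPair, length_unE]; omega

/-- **The BFS ball is polynomial time** (radius in unary). -/
theorem codeFP_ballP : CodeFP (pairE ceE (pairE natE unE)) strE (fun q => ballP q.1.1 q.1.2 q.2.1 q.2.2) := by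
  have h := iterateInv (σ := (GD × List Bool) × ℕ × ℕ) (β := List Bool) (eσ := pairE ceE (pairE natE unE))
    (eβ := strE) (F := fun s S => stepP s.1.1 s.1.2 S) (init := fun s => ball0P s.1.1 s.2.1)
    (k := fun s => s.2.2) (fun s _ S => S.length = s.1.1.1)
    (codeFP_stepP.comp ((fst _ _).fst'.pair (snd _ _))) (codeFP_ball0P.comp ((fst _ _).fst'.pair (snd _ _).fst'))
    (snd _ _).snd' (fun s => length_ball0P _ _) (fun s _ S _ => length_stepP _ _ _) Polynomial.X
    (fun s j S hS => by
      rw [Polynomial.eval_X]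
      change S.length ≤ _
      rw [hS]
      have h1 := K_le_length_gdE s.1.1
      have h2 : (gdE s.1.1).length ≤ (pairE ceE (pairE natE unE) s).length := by
        simp only [pairE_apply, length_boolPair]; omega
      omega)
  exact h.congr fun _ => rfl

/-- Reachability is polynomial time. -/
theorem codeFP_reachP : CodeFP (pairE ceE (pairE natE natE)) bitE (fun q => reachP q.1.1 q.1.2 q.2.1 q.2.2) :=
  (strGetDNat.comp ((codeFP_ballP.comp ((fst _ _).pair ((snd _ _).fst'.pair (fst _ _).fst'.fst'))).pair
    (snd _ _).snd')).congr fun _ => rfl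

/-- The root is polynomial time. -/
theorem codeFP_rootP : CodeFP (pairE ceE natE) natE (fun q => rootP q.1.1 q.1.2 q.2) := by
  have hp : CodeFP (pairE (pairE ceE natE) natE) bitE (fun y => reachP y.1.1.1 y.1.1.2 y.2 y.1.2) :=
    codeFP_reachP.comp ((fst _ _).fst'.pair ((snd _ _).pair (fst _ _).snd'))
  have hf := (rawFind? hp).comp ((CodeFP.id _).pair (urange.comp (fst _ _).fst'.fst'))
  exact ((optGetD natE).comp (hf.pair (const _ 0))).congr fun _ => rfl

/-- The capped least-radius search is polynomial time. -/
theorem codeFP_depthAtP : CodeFP (pairE ceE (pairE natE natE)) natE (fun q => depthAtP q.1.1 q.1.2 q.2.1 q.2.2) := by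
  have hK1 : CodeFP (pairE ceE (pairE natE natE)) unE (fun q => q.1.1.1 + 1) := unSucc.comp (fst _ _).fst'.fst'
  have hp : CodeFP (pairE (pairE ceE (pairE natE natE)) natE) bitE
      (fun y => (ballP y.1.1.1 y.1.1.2 y.1.2.1 (min y.2 (y.1.1.1.1 + 1))).getD y.1.2.2 false) :=
    strGetDNat.comp ((codeFP_ballP.comp ((fst _ _).fst'.pair ((fst _ _).snd'.fst'.pair
      (unOfNatMin.comp ((hK1.comp (fst _ _)).pair (snd _ _)))))).pair (fst _ _).snd'.snd')
  have hf := (rawFind? hp).comp ((CodeFP.id _).pair (urange.comp hK1))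
  exact ((optGetD natE).comp (hf.pair (const _ 0))).congr fun _ => rfl

/-- The depth is polynomial time. -/
theorem codeFP_depthP : CodeFP (pairE ceE natE) natE (fun q => depthP q.1.1 q.1.2 q.2) :=
  (codeFP_depthAtP.comp ((fst _ _).pair (codeFP_rootP.pair (snd _ _)))).congr fun _ => rfl

end Summit.PneNP.PneNP.Theorems.Nc03Reduction
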